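import Literature.AlgebraicGeometry.Resolution.WeightedResolutionDatum
import Literature.AlgebraicGeometry.Resolution.PointBlowupShade
import Mathlib.Order.WellFoundedSet
import Mathlib.Topology.KrullDimension
import HarnessLib

/-!
# Abramovich–Temkin–Włodarczyk (2024): functorial embedded resolution via weighted blowings up — the one-step theorem as a named fact

Topic: `Literature/AlgebraicGeometry/Resolution`. Settled input LIT-4 of the ladder RESOLUTION
(summit `ResolutionOfSingularities`; cell `res-hironaka`, seat `res-lit-5`): the CHARACTERISTIC-ZERO
weighted resolution theorem of

* [ATW24] D. Abramovich, M. Temkin, J. Włodarczyk, *Functorial embedded resolution via weighted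
  blowings up*, Algebra & Number Theory **18**:8 (2024) 1557–1587 [AbramovichTemkinWlodarczyk2024]
  (read on the published pages: Def. 1.2.1 and Thm. 1.2.2 p. 1559, Cor. 1.2.3 pp. 1559–1560,
  Thm. 1.2.5 p. 1560, §3.1 p. 1569, §3.4 p. 1570, Def. 2.4.1 p. 1568, Def. 5.1.1 and the order on
  invariants with the sets `Δₙ` pp. 1574–1575, Thm. 5.1.3 p. 1575, Thm. 5.3.1 p. 1578,
  Thm. 6.1.1 p. 1579, Thm. 6.2.1 p. 1580, Thm. 6.3.1 p. 1581, "Proof of Theorems 1.2.2 and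
  1.2.5" p. 1581, Thms. 8.1.1 / 8.1.3 p. 1583),

stated as ONE named fact `ATW2024WeightedResolution : Prop` (users take
`(h : ATW2024WeightedResolution)`; nothing is asserted), in the tree's weighted-centre vocabulary
of `WeightedResolutionDatum.lean` (`ReesAlgebraData`, `IsRegularWeightedCentre`, the cobordant
blow-up charts `cobordantPlus` / `cobordantPlusι` / `cobordantStrictTransform`) and with the value
type `ATW.Invariant = List ℚ` ordered by `ATW.TruncLex.lt` of `PointBlowupShade.lean`. Nothing is
re-defined; the only new definition is the reducedness predicate
`ReesAlgebraData.IsReducedWeightedCentre` (ATW Def. 2.4.1 (3): "`gcd(w₁, …, w_k) = 1`").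

## What is printed (Thm. 1.2.2, p. 1559, verbatim where short)

"By a DM pair `(X, Y)` we mean a quasicompact Deligne–Mumford stack `Y` smooth over a field of
characteristic zero and a closed substack `X ⊂ Y`" (Def. 1.2.1). "**Theorem 1.2.2** (a step towards
resolution). There is a construction which associates to each DM pair `(X, Y)`, with `X` nonempty,
a semicontinuous function `inv_(X,Y) : X → Δₘ` with values in a well-ordered set `Δₘ` and a reduced
center `J̄ = J̄(X, Y)` with the associated blowing up `F₁(X, Y) : Y₁ → Y` and proper transform
`X₁ ⊂ Y₁` such that the following conditions hold: (1) The vanishing locus: `V(J̄)` is precisely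
the locus where `inv_(X,Y)` attains its maximal value `maxinv(X,Y)`. (2) The invariant drops:
`maxinv(X₁, Y₁) < maxinv(X, Y)`. (3) Functoriality: for any smooth morphism `f : Y' → Y` with
`X' = X ×_Y Y'`, one has that `inv_(X',Y') = inv_(X,Y) ∘ f`. Furthermore, either
`f⁻¹J̄(X, Y) = (1)`, or `J̄(X', Y') = f⁻¹J̄(X, Y)` and hence `(X'₁, Y'₁) = (X₁, Y₁) ×_Y Y₁`.
The set `Δₘ` does not depend on `X` or `Y`, only on `m := dim Y`. It is a well-ordered subset
`Δₘ ⊂ ℚ^{≤m}` of the set of sequences of length at most `m` … Moreover, as `m` varies these sets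
are nested: `Δₘ ⊂ Δₘ₊₁`." The order: "lexicographically, with truncated sequences considered
larger" (§5.1, p. 1575 — the tree's `ATW.TruncLex.lt`). "if `X` is of codimension `c` at
`p ∈ Y`, then `inv_I(p) ≥ (1, …, 1)` of length `c`, and the equality holds if and only if `X` is
smooth at `p`" (p. 1581, last lines; used for Cor. 1.2.3). The centre: a *center* is a valuative
`ℚ`-ideal locally of the form `(x₁^{a₁}, …, x_k^{a_k})` for a regular system of parameters, it is
*reduced* if `wᵢ = 1/aᵢ ∈ ℕ` with `gcd(w₁, …, w_k) = 1` (Def. 2.4.1), and its blowing up is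
`Bl_Y(J̄) := 𝒫roj_Y A_J̄` with `A_J̄ = ⊕ₘ I_{mγ}`, `I_{mγ} = (x^b : Σ wᵢbᵢ ≥ m)` (§3.3–3.4,
p. 1570), where for a graded `𝒪_Y`-algebra "`𝒫roj_Y A := [(Spec_{𝒪_Y} A ∖ S₀)/𝔾ₘ]` where the
vertex `S₀` is the zero scheme of the ideal `⊕_{m>0} Aₘ`" (§3.1, p. 1569); `Y₁` "is again a
smooth stack" (§3.4: "these charts glue to a stack-theoretic modification `Y' → Y` with a smooth
`Y'`"). The invariant on a smooth stack is DEFINED through smooth presentations (Rem. 5.1.4,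
p. 1575: "`inv_{I₁} = inv_{I₀} ∘ pᵢ` … hence `inv_{I₀}` factors through `Y₀ → |Y|`").

## Lean rendering (what is a special case, what is a presentation, what is not typed)

Mathlib has no Deligne–Mumford stacks. The fact below is Thm. 1.2.2 for **variety pairs** — `Y` a
quasi-compact scheme smooth over a field `k` of characteristic `0`, `X` a closed subscheme (a
quasi-coherent ideal sheaf, Mathlib `Scheme.IdealSheafData`) with non-empty support — which are DM
pairs; and the conclusion about the stack `Y₁ = Bl_Y(J̄) = [(Spec_Y A_J̄ ∖ S₀)/𝔾ₘ]` is read on its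
smooth atlas, the `𝔾ₘ`-torsor `Spec_Y A_J̄ ∖ S₀`, chart by chart over the affine opens `U` of `Y`:
this is EXACTLY the tree's cobordant blow-up `(J̄-ReesAlgebraData).cobordantPlus U =
Spec(Γ(U)[t⁻¹, I_{n}(U)tⁿ]) ∖ Vert` of Włodarczyk (2022, Def. 2.3.5: "`B₊ := B ∖ V(t^{w₁}x₁, …,
t^{w_k}x_k)` … corresponds to the weighted blow-up determined by `J`"; p. 10: "Over a field `k`
of characteristic zero, the stack-theoretic quotient of a cobordant blow-up `[B₊/𝔾ₘ] → X` defines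
a stack-theoretic weighted blow-up, in the sense of [ATW19, Section 3.1]"; §2.1.14)
[Wlodarczyk2022]. (The two algebras have the same spectrum off the vertex: on `D(xᵢt^{wᵢ})` one
has `t⁻¹ = xᵢt^{wᵢ−1}/(xᵢt^{wᵢ})`, so `Spec A_J̄ ∖ S₀ = Spec A_J̄[t⁻¹] ∖ Vert`, and with `t⁻¹`
adjoined the degree-`n` piece of `𝒪[t⁻¹, xᵢt^{wᵢ}]` is `(x^b : Σ wᵢbᵢ ≥ n)tⁿ` — the tree's
`weightedMonomialIdeal`, Włodarczyk Lemma 2.1.12.) The proper (= strict) transform `X₁` pulled back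
to the torsor is the tree's `cobordantStrictTransform U X` (Włodarczyk 3.3.12 / Rem. 3.3.13). Since
`B₊(U) → Y₁` is smooth and surjective onto `Y₁|_U`, clause (2) `maxinv(X₁, Y₁) < maxinv(X, Y)` is
equivalent to "`inv` of the strict transform on every chart `B₊(U)` is everywhere below
`maxinv(X, Y)`" by clause (3) / Rem. 5.1.4 — which is how (2) is typed. So every clause below is
the printed clause or its reading on the printed atlas; the fact is a SPECIAL CASE of the theorem
(schemes among DM stacks), never stronger.

* The value sets: `Δ : ℕ → Set ATW.Invariant`, each `Δ m` consisting of sequences of length `≤ m`,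
  well-founded for `ATW.TruncLex.lt` (a strict total order on lists, so "well-ordered"), nested;
  `inv` of a pair with `dim Y ≤ m` (topological Krull dimension) takes values in `Δ m` on `X`.
  The explicit description `Δ₁ = ℕ_{≥1}`, `Δₙ = Δ₁ ⊔ ⨆_{a≥1} {a} × Δₙ₋₁/(a−1)!` (p. 1575) is not
  imposed (weaker, as printed in Thm. 1.2.2).
* "semicontinuous" = upper semicontinuous (Thm. 1.2.5 (1), Thm. 5.1.3 (2)): the sets
  `{y | inv y < v}` are open in `Y` (ATW's `inv_I` is defined on all of `Y`, with value `(0)` off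
  `V(I)`, p. 1574; only its values on `X` are constrained otherwise).
* (iv) "equality `inv = (1,…,1)` iff `X` smooth at `p`": typed as `𝒪_{X,x}` regular (over a field
  of characteristic `0` regular = smooth) iff `inv x = (1, …, 1)` of SOME length — the length is then
  the codimension (a sequence of `c` ones means `c` successive order-one maximal contacts ending in
  the zero ideal, Def. 5.1.1), so no codimension function is needed.
* NOT typed here (and why): the stack form of Thm. 1.2.2 and the ITERATION Cor. 1.2.3 / Thm. 6.3.1
  (2) (termination lives on the `m`-dimensional stacks `Yᵢ`, whose torsor charts have growing
  dimension — a scheme-level iteration needs Włodarczyk's torus bookkeeping, Thms. 1.1.4 / 1.1.6 of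
  [Wlodarczyk2022], a different statement); Thm. 6.3.1 (principalization, weak transforms); the
  local characterisation Thm. 1.2.5 / Thm. 5.3.1 ("`inv_I(p)` is the maximal invariant of a center
  admissible for `I`" — needs valuative `ℚ`-ideals on the Zariski–Riemann space; the tree has the
  polynomial-model version `WeightedBlowup.IsInvCoord`); Thms. 8.1.1 / 8.1.3 (non-embedded and
  coarse resolution of stacks — for schemes their content is functorial resolution in
  characteristic `0`, cf. `Hironaka1964` and `KollarBlowupSequenceFunctors`). McQuillan's
  independent theorem [McQuillan2020] (M. McQuillan, *Very functorial, very fast, and very easy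
  resolution of singularities*, Geom. Funct. Anal. 30 (2020) 858–909; arXiv:1906.06745, Thm. 1.1:
  a modification functor `U ↦ M(U)` on reduced excellent Deligne–Mumford champs of characteristic
  zero, `M(U) → U` "a smoothed weighted blow up in a regular centre", `U = M(U)` iff `U` is
  regular, `inv(M(U)) < inv(U)`, `inv` with values in `ℚ^∞_{≥0}` "with self-bounding
  denominators") is non-embedded, in the generality of excellent champs, and every clause concerns
  champs: not typed (recorded in the cell's SOURCES).
* Relation to `WeightedResolutionDatum p` (same directory): that structure is the ROUTE'S interface
  (one well-ordered `Γ` for all dimensions, perfect ground fields of characteristic `p`, axiom (ii)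
  in `IsBot` form); it is NOT this theorem — by (W6) of `KangarooAtlasCertWeighted` /
  `ATW.TruncLex.exists_descending_chain` the union `⋃ₘ Δₘ` is not well-founded, so ATW's `inv`
  with its printed order does not by itself furnish a single well-ordered `Γ`.

TODO(general form): DM pairs; Cor. 1.2.3 (iteration to `Xₙ` smooth) and Thm. 6.3.1.
-/

noncomputable section

open CategoryTheory AlgebraicGeometry TopologicalSpace

namespace Literature.AlgebraicGeometry.Resolution

universe u

namespace ReesAlgebraData

variable {Y : Scheme.{u}}

/-- `R` is (the Rees algebra of) a **reduced** regular weighted centre: around every point there is a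
weighted chart `(U, u, w)` (`IsWeightedChart`: `Rₙ(U) = (u^α : Σ wᵢαᵢ ≥ n)`, the `uᵢ` part of a
regular system of parameters where they all vanish) whose weights have no common divisor `> 1` —
ATW's reduced center `J̄ = (x₁^{1/w₁}, …, x_k^{1/w_k})`, "`wᵢ = 1/aᵢ` are positive integers with
`gcd(w₁, …, w_k) = 1`". The chart with no parameters (`m = 0`: all positive pieces zero, the zero
centre, whose blowing up is empty — the case of a component of `Y` contained in `X`) is allowed.
[cite: AbramovichTemkinWlodarczyk2024, Def. 2.4.1 (3) (p. 1568)] -/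
def IsReducedWeightedCentre (R : ReesAlgebraData Y) : Prop :=
  ∀ y : Y, ∃ U : Y.affineOpens, y ∈ (U : Y.Opens) ∧
    ∃ (m : ℕ) (u : Fin m → Γ(Y, U)) (w : Fin m → ℕ), R.IsWeightedChart U u w ∧
      (m = 0 ∨ ∀ d : ℕ, (∀ i, d ∣ w i) → d = 1)

/-- A reduced regular weighted centre is a regular weighted centre (Def. 2.4.1 (3): "The center `J` is
reduced if …" — reducedness is a condition on a center). [cite: AbramovichTemkinWlodarczyk2024, Def. 2.4.1 (3) (p. 1568)] -/
theorem IsReducedWeightedCentre.isRegularWeightedCentre {R : ReesAlgebraData Y}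
    (h : R.IsReducedWeightedCentre) : R.IsRegularWeightedCentre := by
  intro y
  obtain ⟨U, hyU, m, u, w, hchart, -⟩ := h y
  exact ⟨U, hyU, m, u, w, hchart⟩

/-- The unit Rees algebra (the unit centre `J = (1)`, empty support — ATW p. 1574: "when `I = (1)`,
in which case `J = (1)`") is a reduced regular weighted centre: the chart with the single unit
parameter of weight `1`, `gcd = 1` (non-vacuity of `IsReducedWeightedCentre`).
[cite: AbramovichTemkinWlodarczyk2024, Def. 2.4.1 (3) (p. 1568) and Def. 5.1.1 ff. (p. 1574)] -/
theorem isReducedWeightedCentre_unit : (unit Y).IsReducedWeightedCentre := by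
  intro y
  obtain ⟨U', hU', hyU', -⟩ :=
    exists_isAffineOpen_mem_and_subset (X := Y) (x := y) (U := ⊤) (Opens.mem_top y)
  refine ⟨⟨U', hU'⟩, hyU', 1, fun _ => 1, fun _ => 1, ⟨fun _ => Nat.one_pos, fun n => ?_, ?_⟩,
    Or.inr fun d hd => Nat.dvd_one.mp (hd 0)⟩
  · rw [unit_piece, Scheme.IdealSheafData.ideal_top, weightedMonomialIdeal_one]
    rfl
  · intro y' hy' h'
    exfalso
    have h0 := h' 0
    rw [map_one] at h0
    exact (IsLocalRing.maximalIdeal.isMaximal _).ne_top (Ideal.eq_top_of_isUnit_mem _ h0 isUnit_one)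

end ReesAlgebraData

/-! ## The named fact -/

/-- NAMED FACT — **Abramovich–Temkin–Włodarczyk, weighted resolution step** (Thm. 1.2.2, for
variety pairs, read on the `𝔾ₘ`-torsor charts of the weighted blowing up; see the module docstring
for the exact correspondence). There are value sets `Δₘ` of sequences of rationals of length `≤ m`,
well-ordered by ATW's order (`ATW.TruncLex.lt`: lexicographic, truncations larger) and nested, and,
for every field `k` of characteristic zero, a construction `(X ⊂ Y) ↦ (inv_(X,Y), J̄(X,Y))` on pairs
`Y → Spec k` smooth quasi-compact, `X ⊆ Y` a closed subscheme with non-empty support, with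
`inv : Y → ATW.Invariant` and `J̄` a reduced regular weighted centre (as Rees algebra data), such
that: (o) `inv` is upper semicontinuous and takes values in `Δₘ` on `X` whenever `dim Y ≤ m`;
(i) the support `V(J̄)` is exactly the set of points of `X` where `inv` is maximal on `X`;
(ii) THE INVARIANT DROPS: for every affine open `U ⊆ Y`, the cobordant chart `B₊(U) → U → Y → Spec k`
(the torsor of `Bl_Y(J̄)|_U`) is smooth and quasi-compact over `k`, and at every point of the strict
transform of `X` on it, `inv` (of the pair strict transform ⊂ `B₊(U)`) is strictly below the maximum
of `inv_(X,Y)` on `X`; (iii) FUNCTORIALITY for smooth `k`-morphisms `φ : Y' → Y`, `X' = X ×_Y Y'`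
(`X.comap φ`) with non-empty support: `inv_(X',Y') = inv_(X,Y) ∘ φ`, and either `φ⁻¹J̄(X,Y) = (1)`
or `J̄(X',Y') = φ⁻¹J̄(X,Y)` piecewise; (iv) for `x ∈ X`, `𝒪_{X,x}` is regular iff
`inv x = (1, …, 1)` (of some length, then the codimension). Special case (schemes) of the printed
theorem on DM pairs; the iteration Cor. 1.2.3 is not part of this fact.
[cite: AbramovichTemkinWlodarczyk2024, Thm. 1.2.2 (p. 1559); §3.1 and §3.4 (pp. 1569–1570); §5.1 and Thm. 5.1.3 (p. 1575); p. 1581 (proof of Thms. 1.2.2/1.2.5, smooth points)] -/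
def ATW2024WeightedResolution : Prop :=
  ∃ Δ : ℕ → Set ATW.Invariant,
    -- the value sets: length ≤ m, well-ordered by `TruncLex`, nested
    (∀ m : ℕ, (∀ v ∈ Δ m, v.length ≤ m) ∧
      (Δ m).WellFoundedOn (fun a b => ATW.TruncLex.lt a b) ∧ Δ m ⊆ Δ (m + 1)) ∧
    ∀ (k : Type u) [Field k] [CharZero k],
    ∃ (inv : ∀ ⦃Y : Scheme.{u}⦄, (Y ⟶ Spec (.of k)) → Y.IdealSheafData → Y → ATW.Invariant)
      (centre : ∀ ⦃Y : Scheme.{u}⦄, (Y ⟶ Spec (.of k)) → Y.IdealSheafData → ReesAlgebraData Y),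
      ∀ ⦃Y : Scheme.{u}⦄ (f : Y ⟶ Spec (.of k)) [Smooth f] [QuasiCompact f]
        (X : Y.IdealSheafData), (X.support : Set Y).Nonempty →
        -- (o) values in `Δ_{dim Y}` on `X`, upper semicontinuity on `Y`
        (∀ m : ℕ, topologicalKrullDim Y ≤ (m : WithBot ℕ∞) →
            ∀ x ∈ (X.support : Set Y), inv f X x ∈ Δ m) ∧
        (∀ v : ATW.Invariant, IsOpen {y : Y | ATW.TruncLex.lt (inv f X y) v}) ∧
        -- (i) the centre: reduced regular weighted, supported exactly on the maximum locus of
        -- `inv` on `X`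
        (centre f X).IsReducedWeightedCentre ∧
        ((centre f X).support =
          {x : Y | x ∈ (X.support : Set Y) ∧
            ∀ x' ∈ (X.support : Set Y), ¬ ATW.TruncLex.lt (inv f X x) (inv f X x')}) ∧
        -- (ii) the weighted blowing up (chart by chart: the torsor `B₊(U)` over the affine open
        -- `U`) is smooth and quasi-compact over `k`, and `inv` of the strict transform drops
        -- below `maxinv (X, Y)` at every point
        (∀ U : Y.affineOpens,
          Smooth ((centre f X).cobordantPlusι U ≫ f) ∧
          QuasiCompact ((centre f X).cobordantPlusι U ≫ f) ∧
          ∀ b ∈ (((centre f X).cobordantStrictTransform U X).support :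
              Set ((centre f X).cobordantPlus U)),
            ∀ x ∈ (X.support : Set Y),
              (∀ x' ∈ (X.support : Set Y), ¬ ATW.TruncLex.lt (inv f X x) (inv f X x')) →
              ATW.TruncLex.lt
                (inv ((centre f X).cobordantPlusι U ≫ f)
                  ((centre f X).cobordantStrictTransform U X) b)
                (inv f X x)) ∧
        -- (iii) functoriality for smooth `k`-morphisms `φ : Y' → Y`, `X' = X ×_Y Y'`
        (∀ ⦃Y' : Scheme.{u}⦄ (f' : Y' ⟶ Spec (.of k)) [Smooth f'] [QuasiCompact f']
            (φ : Y' ⟶ Y) [Smooth φ], φ ≫ f = f' → ((X.comap φ).support : Set Y').Nonempty →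
          (∀ y' : Y', inv f' (X.comap φ) y' = inv f X (φ y')) ∧
          ((∀ n : ℕ, ((centre f X).piece n).comap φ = ⊤) ∨
            ∀ n : ℕ, (centre f' (X.comap φ)).piece n = ((centre f X).piece n).comap φ)) ∧
        -- (iv) `inv` detects the smooth points of `X`
        (∀ x : X.subscheme,
          IsRegularLocalRing (X.subscheme.presheaf.stalk x) ↔
            ∃ c : ℕ, inv f X (X.subschemeι x) = List.replicate c 1)

/-! ## The iteration read on chart towers: "one obtains a sequence … with `X_l = ∅`"

Appended 2026-08-26 (same seat). ATW p. 1559 l.32–33, verbatim: "Since `Δₘ` is well-ordered, composing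
the one-step partial resolution blowings up `F₁(Xᵢ, Yᵢ) : Yᵢ₊₁ → Yᵢ` one obtains a sequence
`(X_l, Y_l) → ⋯ → (X₀, Y₀) = (X, Y)` with `X_l = ∅`." The fact `ATW2024WeightedResolution` above
types ONE step on the torsor charts `B₊(U)`; iterating it chart by chart produces pairs of growing
dimension (`dim B₊(U) = dim Y + 1`), so the well-ordering of `Δ_{dim}` recorded there does not by
itself bound the chart towers. The printed theorem does: the chart pair `(X⁺ ⊂ B₊(U))` is smooth and
surjective over the open substack pair `(X₁ ⊂ Y₁)|_U`, which is again a DM pair of dimension `m`,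
and by functoriality — Thm. 1.2.2 (3), iterated (this is the load-bearing printed input, with
Thm. 6.3.1 (2)(b) for the transforms; Cor. 1.2.3 (2), "the sequence `F(X', Y')` is obtained from
`F(X, Y) ×_Y Y'` by removing all blowings up with empty centers", words the same functoriality for a
whole sequence but is stated "If, in addition" to the hypotheses of Cor. 1.2.3 (1) — `X` generically
reduced and of constant codimension, p. 1560 l.5–8 — and for the sequence with centres nowhere dense in
`Xᵢ`, so it is quoted here for its wording only) — the whole
process on the chart pair is the pull-back of the process on that `m`-dimensional pair with the
empty steps removed; by induction every stage of a chart tower is smooth over an open substack of a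
stage of the printed sequence, whose `X`-part is empty from `l` on. Hence: **along every tower of
charts the strict transform becomes empty after finitely many steps.** This section types that
sentence (`ATW2024.chartTower`, `ATW2024WeightedEmbeddedResolution`) and proves that the new fact
implies the one-step fact (`ATW2024WeightedResolution_of_embedded`), so that a future discharge of
the stronger fact discharges both. (Citation precision of the (v) clause per lane-B note res-ref-b10, 2026-08-27; docstring-only revision, declarations unchanged.) [cite: AbramovichTemkinWlodarczyk2024, Thm. 1.2.2 (3) p. 1559 and p. 1559 l.32–33; Thm. 6.3.1 (2)(b) p. 1581; cf. Cor. 1.2.3 (2) p. 1560 (under the hypotheses of Cor. 1.2.3 (1))]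
-/

namespace ATW2024

variable (k : Type u) [Field k]

/-- A stage of a chart tower: a `k`-scheme `Y → Spec k` with a closed subscheme `X ⊆ Y` (ideal
sheaf). Plumbing for `chartTower`. [cite: AbramovichTemkinWlodarczyk2024, Def. 1.2.1 (p. 1559, "DM pair", scheme case)] -/
structure Stage : Type (u + 1) where
  /-- the ambient scheme -/
  Y : Scheme.{u}
  /-- its structure morphism to `Spec k` -/
  f : Y ⟶ Spec (.of k)
  /-- the closed subscheme (quasi-coherent ideal sheaf) -/
  X : Y.IdealSheafData

variable {k}

/-- **Chart tower** of a centre-valued construction `centre` along a selector `sel` of affine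
charts: stage `0` is the given pair; stage `n + 1` is the cobordant chart `B₊(U)` of the centre of
stage `n` over the affine open `U = sel(stage n)`, with structure map `B₊(U) → U ⊆ Yₙ → Spec k` and
the strict transform of `Xₙ` — the printed composite "`F₁(Xᵢ, Yᵢ) : Yᵢ₊₁ → Yᵢ`" read on one torsor
chart per step. A real definition by recursion; meaningful for the `centre` of
`ATW2024WeightedEmbeddedResolution`. [cite: AbramovichTemkinWlodarczyk2024, p. 1559 l.32–33 (the composed sequence); §3.1 p. 1569 (torsor presentation)] -/
noncomputable def chartTower
    (centre : ∀ ⦃Y : Scheme.{u}⦄, (Y ⟶ Spec (.of k)) → Y.IdealSheafData → ReesAlgebraData Y)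
    (sel : ∀ ⦃Y : Scheme.{u}⦄, (Y ⟶ Spec (.of k)) → Y.IdealSheafData → Y.affineOpens)
    (s : Stage k) : ℕ → Stage k
  | 0 => s
  | n + 1 =>
    let t := chartTower centre sel s n
    ⟨(centre t.f t.X).cobordantPlus (sel t.f t.X),
      (centre t.f t.X).cobordantPlusι (sel t.f t.X) ≫ t.f,
      (centre t.f t.X).cobordantStrictTransform (sel t.f t.X) t.X⟩

/-- Stage `0` of a chart tower is the given pair. [cite: AbramovichTemkinWlodarczyk2024, p. 1559 l.32–33] -/
@[simp] theorem chartTower_zero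
    (centre : ∀ ⦃Y : Scheme.{u}⦄, (Y ⟶ Spec (.of k)) → Y.IdealSheafData → ReesAlgebraData Y)
    (sel : ∀ ⦃Y : Scheme.{u}⦄, (Y ⟶ Spec (.of k)) → Y.IdealSheafData → Y.affineOpens)
    (s : Stage k) : chartTower centre sel s 0 = s := rfl

/-- The successor stage of a chart tower, unfolded. [cite: AbramovichTemkinWlodarczyk2024, p. 1559 l.32–33] -/
theorem chartTower_succ
    (centre : ∀ ⦃Y : Scheme.{u}⦄, (Y ⟶ Spec (.of k)) → Y.IdealSheafData → ReesAlgebraData Y)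
    (sel : ∀ ⦃Y : Scheme.{u}⦄, (Y ⟶ Spec (.of k)) → Y.IdealSheafData → Y.affineOpens)
    (s : Stage k) (n : ℕ) :
    chartTower centre sel s (n + 1) =
      ⟨(centre (chartTower centre sel s n).f (chartTower centre sel s n).X).cobordantPlus
          (sel (chartTower centre sel s n).f (chartTower centre sel s n).X),
        (centre (chartTower centre sel s n).f (chartTower centre sel s n).X).cobordantPlusι
          (sel (chartTower centre sel s n).f (chartTower centre sel s n).X) ≫
          (chartTower centre sel s n).f,
        (centre (chartTower centre sel s n).f (chartTower centre sel s n).X).cobordantStrictTransform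
          (sel (chartTower centre sel s n).f (chartTower centre sel s n).X)
          (chartTower centre sel s n).X⟩ := rfl

end ATW2024

/-- NAMED FACT — **Abramovich–Temkin–Włodarczyk, weighted embedded resolution: the step AND its
termination** (Thm. 1.2.2 with "one obtains a sequence `(X_l, Y_l) → ⋯ → (X₀, Y₀) = (X, Y)` with
`X_l = ∅`", p. 1559 l.32–33, both read on the torsor charts of the weighted blowings up). Same data
and clauses (o)–(iv) as `ATW2024WeightedResolution` (verbatim), plus (v) TERMINATION: for every
variety pair `(X ⊆ Y)` over `k` (`Y → Spec k` smooth quasi-compact, `X` with non-empty support) and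
EVERY selector of affine charts, the chart tower `ATW2024.chartTower centre sel` starting at `(Y, X)`
has a stage whose strict transform has empty support (see the section docstring for why the printed
functoriality makes this a faithful reading and not a new claim). Special case (schemes) of the
printed statements on DM pairs. Users take `(h : ATW2024WeightedEmbeddedResolution)`; it implies
`ATW2024WeightedResolution` (`ATW2024WeightedResolution_of_embedded`).
[cite: AbramovichTemkinWlodarczyk2024, Thm. 1.2.2 (3) (p. 1559) iterated and p. 1559 l.32–33; Thm. 6.3.1 (2)(b) (p. 1581); cf. Cor. 1.2.3 (2) (p. 1560, under the hypotheses of Cor. 1.2.3 (1))] -/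
def ATW2024WeightedEmbeddedResolution : Prop :=
  ∃ Δ : ℕ → Set ATW.Invariant,
    (∀ m : ℕ, (∀ v ∈ Δ m, v.length ≤ m) ∧
      (Δ m).WellFoundedOn (fun a b => ATW.TruncLex.lt a b) ∧ Δ m ⊆ Δ (m + 1)) ∧
    ∀ (k : Type u) [Field k] [CharZero k],
    ∃ (inv : ∀ ⦃Y : Scheme.{u}⦄, (Y ⟶ Spec (.of k)) → Y.IdealSheafData → Y → ATW.Invariant)
      (centre : ∀ ⦃Y : Scheme.{u}⦄, (Y ⟶ Spec (.of k)) → Y.IdealSheafData → ReesAlgebraData Y),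
      (∀ ⦃Y : Scheme.{u}⦄ (f : Y ⟶ Spec (.of k)) [Smooth f] [QuasiCompact f]
        (X : Y.IdealSheafData), (X.support : Set Y).Nonempty →
        (∀ m : ℕ, topologicalKrullDim Y ≤ (m : WithBot ℕ∞) →
            ∀ x ∈ (X.support : Set Y), inv f X x ∈ Δ m) ∧
        (∀ v : ATW.Invariant, IsOpen {y : Y | ATW.TruncLex.lt (inv f X y) v}) ∧
        (centre f X).IsReducedWeightedCentre ∧
        ((centre f X).support =
          {x : Y | x ∈ (X.support : Set Y) ∧
            ∀ x' ∈ (X.support : Set Y), ¬ ATW.TruncLex.lt (inv f X x) (inv f X x')}) ∧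
        (∀ U : Y.affineOpens,
          Smooth ((centre f X).cobordantPlusι U ≫ f) ∧
          QuasiCompact ((centre f X).cobordantPlusι U ≫ f) ∧
          ∀ b ∈ (((centre f X).cobordantStrictTransform U X).support :
              Set ((centre f X).cobordantPlus U)),
            ∀ x ∈ (X.support : Set Y),
              (∀ x' ∈ (X.support : Set Y), ¬ ATW.TruncLex.lt (inv f X x) (inv f X x')) →
              ATW.TruncLex.lt
                (inv ((centre f X).cobordantPlusι U ≫ f)
                  ((centre f X).cobordantStrictTransform U X) b)
                (inv f X x)) ∧
        (∀ ⦃Y' : Scheme.{u}⦄ (f' : Y' ⟶ Spec (.of k)) [Smooth f'] [QuasiCompact f']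
            (φ : Y' ⟶ Y) [Smooth φ], φ ≫ f = f' → ((X.comap φ).support : Set Y').Nonempty →
          (∀ y' : Y', inv f' (X.comap φ) y' = inv f X (φ y')) ∧
          ((∀ n : ℕ, ((centre f X).piece n).comap φ = ⊤) ∨
            ∀ n : ℕ, (centre f' (X.comap φ)).piece n = ((centre f X).piece n).comap φ)) ∧
        (∀ x : X.subscheme,
          IsRegularLocalRing (X.subscheme.presheaf.stalk x) ↔
            ∃ c : ℕ, inv f X (X.subschemeι x) = List.replicate c 1)) ∧
      -- (v) TERMINATION along every chart tower: "… with `X_l = ∅`"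
      (∀ ⦃Y : Scheme.{u}⦄ (f : Y ⟶ Spec (.of k)) [Smooth f] [QuasiCompact f]
        (X : Y.IdealSheafData), (X.support : Set Y).Nonempty →
        ∀ sel : ∀ ⦃Y : Scheme.{u}⦄, (Y ⟶ Spec (.of k)) → Y.IdealSheafData → Y.affineOpens,
          ∃ n : ℕ, ((ATW2024.chartTower centre sel ⟨Y, f, X⟩ n).X.support :
            Set (ATW2024.chartTower centre sel ⟨Y, f, X⟩ n).Y) = ∅)

/-- The fact with termination implies the one-step fact (its clauses (o)–(iv) are copied verbatim),
so discharging `ATW2024WeightedEmbeddedResolution` discharges `ATW2024WeightedResolution`.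
[cite: AbramovichTemkinWlodarczyk2024, Thm. 1.2.2 (p. 1559)] -/
theorem ATW2024WeightedResolution_of_embedded (h : ATW2024WeightedEmbeddedResolution.{u}) :
    ATW2024WeightedResolution.{u} := by
  obtain ⟨Δ, hΔ, h⟩ := h
  refine ⟨Δ, hΔ, fun k _ _ => ?_⟩
  obtain ⟨inv, centre, hstep, -⟩ := h k
  exact ⟨inv, centre, hstep⟩

end Literature.AlgebraicGeometry.Resolution

end
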